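import Literature.MathematicalPhysics.QuantumLattice.BdGBondHamiltonianTrotterDeterminant
import Literature.MathematicalPhysics.QuantumLattice.TransferOperatorDual
import HarnessLib

/-!
# Route BalabanIR — crux 4 `BirGappedPhaseReduction` / 4R (items `stmt-HubbardSuperconductivity-2082`, `…-14846`):
# hypothesis (R) for fermion-induced weights — time reflection conjugates the Trotter weight

Hypothesis (R) of the restated engine (crux 2R, `BirComplexStableXYR`: `c_{n∘R} = conj c_{-n}`, i.e.
`F(φ ∘ R) = conj F(φ)` for the time reflection `R`) is automatic for every action obtained by
integrating out the fermions of a Hamiltonian model in imaginary time. On the many-body trace of a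
Trotterised BdG reference this is the identity

* **`trace_prod_gibbsWeight_bdgBondHamiltonian_rev`** — for Hermitian hopping data `τ_t` and ARBITRARY
  slice pairings `Δ_t` (e.g. a space-time pair-phase field), reversing the time order of the slices
  conjugates the weight: `Tr ∏_t e^{-aH_BdG(τ_{R t}, Δ_{R t}, μ)} = conj Tr ∏_t e^{-aH_BdG(τ_t, Δ_t, μ)}`,
  `R = Fin.rev` (from `star_trace_prod_map_gibbsWeight_bdgBondHamiltonian`,
  `Literature/…/BdGBondHamiltonianTrotterDeterminant`);
* `trace_prod_gibbsWeight_bdgBondHamiltonian_phase_rev` — the instance for a phase-dressed pairing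
  `Δ(x,y)·w(θ_t x, θ_t y)`: `W(θ ∘ R) = conj W(θ)`;
* `im_trace_prod_gibbsWeight_bdgBondHamiltonian_eq_zero_of_rev` — a reflection-symmetric history has a
  REAL weight.

`Theses`-free, no definitions; `--supports` the crux. [folklore]
-/

noncomputable section

namespace Summit.HubbardSuperconductivity.HubbardSuperconductivity.Theorems

namespace BirBdG

open Matrix Literature.MathematicalPhysics.QuantumLattice

section TimeReflection

variable {Λ : Type*} [LinearOrder Λ] [Fintype Λ]

/-- **(R) for fermion-induced weights: time reflection conjugates the Trotter weight.** For
Hermitian hopping data and arbitrary slice pairings,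
`Tr ∏_t e^{-aH_BdG(τ_{R t}, Δ_{R t}, μ)} = conj Tr ∏_t e^{-aH_BdG(τ_t, Δ_t, μ)}`, `R = Fin.rev`.
[folklore] -/
theorem trace_prod_gibbsWeight_bdgBondHamiltonian_rev {M : ℕ} (τ Δ : Fin M → Λ → Λ → ℂ)
    (hτ : ∀ t x y, star (τ t x y) = τ t y x) (μ a : ℝ) :
    ((List.ofFn fun t => Matrix.gibbsWeight a
        (bdgBondHamiltonian (τ (Fin.rev t)) (Δ (Fin.rev t)) μ)).prod).trace =
      star ((List.ofFn fun t => Matrix.gibbsWeight a (bdgBondHamiltonian (τ t) (Δ t) μ)).prod).trace := by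
  have h := star_trace_prod_map_gibbsWeight_bdgBondHamiltonian a μ (List.ofFn fun t => (τ t, Δ t))
    (fun p hp x y => by
      obtain ⟨t, rfl⟩ := (List.mem_ofFn' _ _).mp hp
      exact hτ t x y)
  rw [← ofFn_comp_rev, List.map_ofFn, List.map_ofFn] at h
  exact h.symm

/-- **`W(θ ∘ R) = conj W(θ)`** for a phase-dressed pairing `Δ(x,y)·w(θ_t x, θ_t y)` over Hermitian
hopping. [folklore] -/
theorem trace_prod_gibbsWeight_bdgBondHamiltonian_phase_rev (τ Δ : Λ → Λ → ℂ)
    (hτ : ∀ x y, star (τ x y) = τ y x) (w : ℝ → ℝ → ℂ) (μ a : ℝ) {M : ℕ} (θ : Fin M → Λ → ℝ) :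
    ((List.ofFn fun t => Matrix.gibbsWeight a
        (bdgBondHamiltonian τ (fun u v => Δ u v * w (θ (Fin.rev t) u) (θ (Fin.rev t) v)) μ)).prod).trace =
      star ((List.ofFn fun t => Matrix.gibbsWeight a
        (bdgBondHamiltonian τ (fun u v => Δ u v * w (θ t u) (θ t v)) μ)).prod).trace :=
  trace_prod_gibbsWeight_bdgBondHamiltonian_rev (fun _ => τ)
    (fun t u v => Δ u v * w (θ t u) (θ t v)) (fun _ => hτ) μ a

/-- A time-reflection-symmetric history (`Δ_{R t} = Δ_t`, `τ_{R t} = τ_t`) has a REAL Trotter weight.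
[folklore] -/
theorem im_trace_prod_gibbsWeight_bdgBondHamiltonian_eq_zero_of_rev {M : ℕ} (τ Δ : Fin M → Λ → Λ → ℂ)
    (hτ : ∀ t x y, star (τ t x y) = τ t y x) (hτR : ∀ t, τ (Fin.rev t) = τ t)
    (hΔR : ∀ t, Δ (Fin.rev t) = Δ t) (μ a : ℝ) :
    (((List.ofFn fun t => Matrix.gibbsWeight a (bdgBondHamiltonian (τ t) (Δ t) μ)).prod).trace).im = 0 := by
  have h := trace_prod_gibbsWeight_bdgBondHamiltonian_rev τ Δ hτ μ a
  simp only [hτR, hΔR] at h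
  exact Complex.conj_eq_iff_im.mp h.symm

end TimeReflection

end BirBdG

end Summit.HubbardSuperconductivity.HubbardSuperconductivity.Theorems
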